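import Summits.QuantumFields.YangMills.Theorems.CoarseStiffnessTailCappedCoarseStiffnessLPivotPeeling

/-!
# Route `CoarseStiffnessTail` — THE CORNER-COMB FAMILY: a peelable plaquette family with `(d−1)(|T|−1)` members on every torus, whence
# `Z_P(β) ≤ linkMass(β)^{(d−1)(|T|−1)}` (lead's certificate, seat `ym-line-cst-p1` g15; helper on 25301, stub S3 = uniform mean action)

THE FAMILY (finest torus `T₁^{(0)}` of any `Params`, `n = 2L^{m+K}` sites per direction, coordinates in `ZMod n`, `c* = (−1,…,−1)` the corner).
For a site `x ≠ c*` let `k(x)` be the least direction with `x_k ≠ −1`.  The family `𝔉` consists of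
  * (F) the plaquettes `⟨x, μ, ν⟩` with `μ = k(x) < ν`, pivot = the 4th link `⟨x, ν⟩`;
  * (W) the plaquettes `⟨x, μ, ν⟩` with `μ < ν = k(x)`, pivot = the 1st link `⟨x, μ⟩`
— in coordinates: `x_i = −1` for `i < μ`, and (`x_μ ≠ −1`) or (`x_i = −1` for `i < ν` and `x_ν ≠ −1`).  Its pivots are exactly the bonds
`⟨x, δ⟩` with `x ≠ c*` and `δ ≠ k(x)`, so `#𝔉 = d·|T| − d − (|T| − 1) = (d−1)(|T|−1)` (`card_cornerComb`); the FREE bonds are the `d` corner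
bonds `⟨c*, δ⟩` and the comb tree `{⟨x, k(x)⟩ : x ≠ c*}` — by Euler characteristic no family with private pivots can do better.
PEELING ORDER (rank `ρ`): lexicographic in (`μ`; W before F; for W: (`ν`, `val x_ν`); for F: `val x_μ`).  The privacy check
`piv q ∈ links p ∧ p ≠ q ⇒ ρ p < ρ q` (`rank_lt_of_pivot_mem`) is a finite case analysis on which of the four links of `p` the pivot of `q` is.

THIS FILE (part 1 of 2): §1 coordinates (least non-corner direction, uniqueness/existence), §2 the rank comparisons, §3 ★ `pivot_injOn` and
★ `rank_lt_of_pivot_mem` (privacy in order).  The companion `…LCornerCombBound` counts the family and concludes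
`Z_P(β) ≤ linkMass(β)^{(d−1)(|T|−1)}` (any regular `G`, `β ≥ 0`) — the N13 axial-tree bound had `(d−1)(1−1/n)|T|` pivots, i.e. a deficit of
`(d−1)(|T|/n − 1)` Gaussian factors.

HONEST SCOPE.  Finite combinatorics of the torus + the companion's peeling theorem; nothing of Bałaban's is asserted; the crux 25301, its
stubs, `HistoryTailL` 19936 stay OPEN; `YM3TorusSU2` (R3, RECORD rung, not Clay) is NOT proved; the Yang–Mills mass gap is NOT touched.

References: I. Montvay, G. Münster, *Quantum Fields on a Lattice* (1994) §3.2.5 [MontvayMunster1994] (maximal trees / bond elimination);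
T. Bałaban, CMP **102** (1985) 255–275 [Balaban1985UV3] ((1)–(3) p.256).
-/

noncomputable section

open scoped BigOperators

namespace Summit.QuantumFields.YangMills.Theorems.CoarseStiffnessTailCornerCombFamily

open Literature.MathematicalPhysics.QuantumFieldTheory.Balaban1983to89 Literature.MathematicalPhysics.QuantumFieldTheory.Balaban1983to89.Missing
open Summit.QuantumFields.BalabanUV.T4Continuum.NE7b.BarePartitionFnDecay (one_ne_zero_coord)
open Summit.QuantumFields.YangMills.BalabanUVNodes.N13WilsonPartitionFnAxialTreeUpperBound (val_add_one_of_ne_neg_one)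

variable (P : Params)

/-! ## §1 Coordinates: the least non-corner direction is unique; plaquette extensionality -/

section Coord

/-- `−1 ≠ 0` in `ZMod n`, `n = 2L^{m+K} > 1`. [folklore] -/
theorem neg_one_ne_zero_coord : (-1 : ZMod (P.sitesPerDir 0)) ≠ 0 :=
  neg_ne_zero.mpr (one_ne_zero_coord P)

/-- `−1 + 1 ≠ −1` in `ZMod n` (`n > 1`). [folklore] -/
theorem neg_one_add_one_ne_neg_one : (-1 : ZMod (P.sitesPerDir 0)) + 1 ≠ -1 := by
  rw [neg_add_cancel]; exact (neg_one_ne_zero_coord P).symm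

/-- UNIQUENESS OF THE LEAST NON-CORNER DIRECTION: if `x_i = −1` for `i < a`, `x_a ≠ −1`, and the same for `b`, then `a = b`. [folklore] -/
theorem leastDir_unique (x : Site P 0) {a b : Fin P.d} (ha : ∀ i, i < a → x i = -1) (ha' : x a ≠ -1)
    (hb : ∀ i, i < b → x i = -1) (hb' : x b ≠ -1) : a = b := by
  rcases lt_trichotomy a b with h | h | h
  · exact absurd (hb a h) ha'
  · exact h
  · exact absurd (ha b h) hb'

/-- EXISTENCE of the least non-corner direction for `x ≠ c*`. [folklore] -/
theorem exists_leastDir (x : Site P 0) (hx : x ≠ fun _ => -1) :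
    ∃ k : Fin P.d, (∀ i, i < k → x i = -1) ∧ x k ≠ -1 := by
  classical
  have hne : (Finset.univ.filter fun i : Fin P.d => x i ≠ -1).Nonempty := by
    by_contra h
    rw [Finset.not_nonempty_iff_eq_empty, Finset.filter_eq_empty_iff] at h
    exact hx (funext fun i => by simpa using h (Finset.mem_univ i))
  obtain ⟨k, hk, hmin⟩ := Finset.exists_min_image _ id hne
  refine ⟨k, fun i hi => ?_, (Finset.mem_filter.1 hk).2⟩
  by_contra hxi
  have := hmin i (Finset.mem_filter.2 ⟨Finset.mem_univ _, hxi⟩)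
  exact absurd hi (not_lt.2 this)

/-- A plaquette is determined by its source and its two directions. [folklore] -/
theorem plaq_eq {p q : Plaq P 0} (h1 : p.src = q.src) (h2 : p.μ = q.μ) (h3 : p.ν = q.ν) : p = q := by
  obtain ⟨ps, pμ, pν, ph⟩ := p; obtain ⟨qs, qμ, qν, qh⟩ := q
  simp only at h1 h2 h3; subst h1; subst h2; subst h3; rfl

/-- Coordinates of `x + e_μ`: the `μ`-th is `x_μ + 1`, the others unchanged. [folklore] -/
theorem shift_apply (x : Site P 0) (μ i : Fin P.d) : (x.shift μ) i = if i = μ then x μ + 1 else x i := by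
  unfold Site.shift
  by_cases h : i = μ
  · subst h; simp
  · simp [h]

end Coord

/-! ## §2 The rank: elementary comparisons -/

section Rank

/-- The within-stage key is below the stage width `(d+1)·n`: W-type. [folklore] -/
theorem keyW_lt (ν : Fin P.d) (c : ZMod (P.sitesPerDir 0)) : ν.val * P.sitesPerDir 0 + c.val < (P.d + 1) * P.sitesPerDir 0 := by
  have h1 : ν.val + 1 ≤ P.d := ν.isLt
  have h2 : c.val < P.sitesPerDir 0 := ZMod.val_lt c
  have h3 : (ν.val + 1) * P.sitesPerDir 0 ≤ P.d * P.sitesPerDir 0 := Nat.mul_le_mul_right _ h1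
  nlinarith

/-- The within-stage key is below the stage width `(d+1)·n`: F-type. [folklore] -/
theorem keyF_lt (c : ZMod (P.sitesPerDir 0)) : P.d * P.sitesPerDir 0 + c.val < (P.d + 1) * P.sitesPerDir 0 := by
  have h2 : c.val < P.sitesPerDir 0 := ZMod.val_lt c
  nlinarith

/-- STAGE-MAJOR: a smaller first direction gives a smaller rank, whatever the keys (`key < (d+1)n`). [folklore] -/
theorem rank_lt_of_stage_lt {μ μ' : Fin P.d} (h : μ < μ') {s s' : ℕ} (hs : s < (P.d + 1) * P.sitesPerDir 0) :
    μ.val * ((P.d + 1) * P.sitesPerDir 0) + s < μ'.val * ((P.d + 1) * P.sitesPerDir 0) + s' := by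
  have h1 : μ.val + 1 ≤ μ'.val := h
  have h3 : (μ.val + 1) * ((P.d + 1) * P.sitesPerDir 0) ≤ μ'.val * ((P.d + 1) * P.sitesPerDir 0) := Nat.mul_le_mul_right _ h1
  nlinarith

/-- W BEFORE F within a stage: `ν·n + val < d·n ≤ d·n + val'`. [folklore] -/
theorem keyW_lt_keyF (ν : Fin P.d) (c c' : ZMod (P.sitesPerDir 0)) :
    ν.val * P.sitesPerDir 0 + c.val < P.d * P.sitesPerDir 0 + c'.val := by
  have h1 : ν.val + 1 ≤ P.d := ν.isLt
  have h2 : c.val < P.sitesPerDir 0 := ZMod.val_lt c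
  have h3 : (ν.val + 1) * P.sitesPerDir 0 ≤ P.d * P.sitesPerDir 0 := Nat.mul_le_mul_right _ h1
  nlinarith

/-- Within W: a smaller second direction gives a smaller key. [folklore] -/
theorem keyW_lt_keyW_of_lt {ν ν' : Fin P.d} (h : ν < ν') (c c' : ZMod (P.sitesPerDir 0)) :
    ν.val * P.sitesPerDir 0 + c.val < ν'.val * P.sitesPerDir 0 + c'.val := by
  have h1 : ν.val + 1 ≤ ν'.val := h
  have h2 : c.val < P.sitesPerDir 0 := ZMod.val_lt c
  have h3 : (ν.val + 1) * P.sitesPerDir 0 ≤ ν'.val * P.sitesPerDir 0 := Nat.mul_le_mul_right _ h1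
  nlinarith

end Rank

/-! ## §3 The corner-comb family: pivots are links, injectivity, privacy in order -/

section Family

/-- The pivot `if x_μ = −1 then ⟨x, μ⟩ else ⟨x, ν⟩` is the 1st or the 4th link. [folklore] -/
theorem pivot_is_link (p : Plaq P 0) :
    (if p.src p.μ = -1 then (⟨p.src, p.μ⟩ : PBond P 0) else ⟨p.src, p.ν⟩) = ⟨p.src, p.μ⟩ ∨
    (if p.src p.μ = -1 then (⟨p.src, p.μ⟩ : PBond P 0) else ⟨p.src, p.ν⟩) = ⟨p.src.shift p.μ, p.ν⟩ ∨
    (if p.src p.μ = -1 then (⟨p.src, p.μ⟩ : PBond P 0) else ⟨p.src, p.ν⟩) = ⟨p.src.shift p.ν, p.μ⟩ ∨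
    (if p.src p.μ = -1 then (⟨p.src, p.μ⟩ : PBond P 0) else ⟨p.src, p.ν⟩) = ⟨p.src, p.ν⟩ := by
  by_cases h : p.src p.μ = -1
  · exact Or.inl (by rw [if_pos h])
  · exact Or.inr (Or.inr (Or.inr (by rw [if_neg h])))

/-- A W-type member (`x_μ = −1`) satisfies `x_i = −1` for `i < ν` and `x_ν ≠ −1`. [folklore] -/
theorem memW_elim {p : Plaq P 0}
    (hp : (∀ i, i < p.μ → p.src i = -1) ∧ (p.src p.μ ≠ -1 ∨ ((∀ i, i < p.ν → p.src i = -1) ∧ p.src p.ν ≠ -1)))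
    (hW : p.src p.μ = -1) : (∀ i, i < p.ν → p.src i = -1) ∧ p.src p.ν ≠ -1 := by
  rcases hp.2 with h | h
  · exact absurd hW h
  · exact h

/-- **INJECTIVITY OF THE PIVOT ON THE FAMILY.** [folklore] -/
theorem pivot_injOn {p q : Plaq P 0}
    (hp : (∀ i, i < p.μ → p.src i = -1) ∧ (p.src p.μ ≠ -1 ∨ ((∀ i, i < p.ν → p.src i = -1) ∧ p.src p.ν ≠ -1)))
    (hq : (∀ i, i < q.μ → q.src i = -1) ∧ (q.src q.μ ≠ -1 ∨ ((∀ i, i < q.ν → q.src i = -1) ∧ q.src q.ν ≠ -1)))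
    (h : (if p.src p.μ = -1 then (⟨p.src, p.μ⟩ : PBond P 0) else ⟨p.src, p.ν⟩) =
      (if q.src q.μ = -1 then (⟨q.src, q.μ⟩ : PBond P 0) else ⟨q.src, q.ν⟩)) : p = q := by
  by_cases hpW : p.src p.μ = -1 <;> by_cases hqW : q.src q.μ = -1
  · -- W / W
    rw [if_pos hpW, if_pos hqW] at h
    have hs : p.src = q.src := congrArg PBond.src h
    have hμ : p.μ = q.μ := congrArg PBond.dir h
    obtain ⟨hp1, hp2⟩ := memW_elim P hp hpW
    obtain ⟨hq1, hq2⟩ := memW_elim P hq hqW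
    rw [hs] at hp1 hp2
    exact plaq_eq P hs hμ (leastDir_unique P q.src hp1 hp2 hq1 hq2)
  · -- W / F : `x = y`, `μ_p = ν_q`; then `x_{μ_q} = −1` (from `p`, `μ_q < ν_q = μ_p < ν_p`) contradicts `q` F-type
    rw [if_pos hpW, if_neg hqW] at h
    have hs : p.src = q.src := congrArg PBond.src h
    have hμ : p.μ = q.ν := congrArg PBond.dir h
    obtain ⟨hp1, _⟩ := memW_elim P hp hpW
    have h1 : p.src q.μ = -1 := hp1 q.μ (lt_trans q.hμν (hμ ▸ p.hμν))
    rw [hs] at h1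
    exact absurd h1 hqW
  · -- F / W (symmetric)
    rw [if_neg hpW, if_pos hqW] at h
    have hs : p.src = q.src := congrArg PBond.src h
    have hν : p.ν = q.μ := congrArg PBond.dir h
    obtain ⟨hq1, _⟩ := memW_elim P hq hqW
    have h1 : q.src p.μ = -1 := hq1 p.μ (lt_trans p.hμν (hν ▸ q.hμν))
    rw [← hs] at h1
    exact absurd h1 hpW
  · -- F / F
    rw [if_neg hpW, if_neg hqW] at h
    have hs : p.src = q.src := congrArg PBond.src h
    have hν : p.ν = q.ν := congrArg PBond.dir h
    have hp1 := hp.1; have hq1 := hq.1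
    rw [hs] at hp1 hpW
    exact plaq_eq P hs (leastDir_unique P q.src hp1 hpW hq1 hqW) hν

/-- **★ PRIVACY IN ORDER**: if the pivot of `q` is a link of another member `p`, then `ρ p < ρ q` for the lexicographic rank
`ρ = μ·(d+1)n + [W: ν·n + val x_ν | F: d·n + val x_μ]`. [folklore] -/
theorem rank_lt_of_pivot_mem {p q : Plaq P 0}
    (hp : (∀ i, i < p.μ → p.src i = -1) ∧ (p.src p.μ ≠ -1 ∨ ((∀ i, i < p.ν → p.src i = -1) ∧ p.src p.ν ≠ -1)))
    (hq : (∀ i, i < q.μ → q.src i = -1) ∧ (q.src q.μ ≠ -1 ∨ ((∀ i, i < q.ν → q.src i = -1) ∧ q.src q.ν ≠ -1)))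
    (hne : p ≠ q)
    (hmem : (if q.src q.μ = -1 then (⟨q.src, q.μ⟩ : PBond P 0) else ⟨q.src, q.ν⟩) = ⟨p.src, p.μ⟩ ∨
      (if q.src q.μ = -1 then (⟨q.src, q.μ⟩ : PBond P 0) else ⟨q.src, q.ν⟩) = ⟨p.src.shift p.μ, p.ν⟩ ∨
      (if q.src q.μ = -1 then (⟨q.src, q.μ⟩ : PBond P 0) else ⟨q.src, q.ν⟩) = ⟨p.src.shift p.ν, p.μ⟩ ∨
      (if q.src q.μ = -1 then (⟨q.src, q.μ⟩ : PBond P 0) else ⟨q.src, q.ν⟩) = ⟨p.src, p.ν⟩) :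
    p.μ.val * ((P.d + 1) * P.sitesPerDir 0) +
        (if p.src p.μ = -1 then p.ν.val * P.sitesPerDir 0 + (p.src p.ν).val else P.d * P.sitesPerDir 0 + (p.src p.μ).val) <
      q.μ.val * ((P.d + 1) * P.sitesPerDir 0) +
        (if q.src q.μ = -1 then q.ν.val * P.sitesPerDir 0 + (q.src q.ν).val else P.d * P.sitesPerDir 0 + (q.src q.μ).val) := by
  have hp1 := hp.1
  have hq1 := hq.1
  have h10 := neg_one_add_one_ne_neg_one P
  by_cases hqW : q.src q.μ = -1
  · ---------------- `q` of W-type: pivot `⟨y, μ'⟩`, `y_i = −1 (i < ν')`, `y_{ν'} ≠ −1`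
    obtain ⟨hqW1, hqν⟩ := memW_elim P hq hqW
    rw [if_pos hqW] at hmem ⊢
    rcases hmem with h | h | h | h
    · -- (c1) `⟨y, μ'⟩ = ⟨x, μ⟩`
      have hs : q.src = p.src := congrArg PBond.src h
      have hμ : q.μ = p.μ := congrArg PBond.dir h
      by_cases hpW : p.src p.μ = -1
      · obtain ⟨hpW1, hpν⟩ := memW_elim P hp hpW
        exfalso
        rcases lt_trichotomy p.ν q.ν with hlt | heq | hgt
        · exact hpν (hs ▸ hqW1 p.ν hlt)
        · exact hne (plaq_eq P hs.symm hμ.symm heq)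
        · exact hqν (hs.symm ▸ hpW1 q.ν hgt)
      · exact absurd (hs ▸ hμ ▸ hqW) hpW
    · -- (c4) `⟨y, μ'⟩ = ⟨x + e_μ, ν⟩`
      have hs : q.src = p.src.shift p.μ := congrArg PBond.src h
      have hμ : q.μ = p.ν := congrArg PBond.dir h
      have hstage : p.μ < q.μ := hμ ▸ p.hμν
      by_cases hpW : p.src p.μ = -1
      · exfalso
        have h1 : q.src p.μ = -1 := hqW1 p.μ (lt_trans hstage q.hμν)
        rw [hs, shift_apply, if_pos rfl, hpW] at h1
        exact h10 h1
      · rw [if_neg hpW]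
        exact rank_lt_of_stage_lt P hstage (keyF_lt P _)
    · -- (c2) `⟨y, μ'⟩ = ⟨x + e_ν, μ⟩`
      have hs : q.src = p.src.shift p.ν := congrArg PBond.src h
      have hμ : q.μ = p.μ := congrArg PBond.dir h
      have hyμ : q.src p.μ = p.src p.μ := by rw [hs, shift_apply, if_neg (Fin.ne_of_lt p.hμν)]
      by_cases hpW : p.src p.μ = -1
      · obtain ⟨hpW1, hpν⟩ := memW_elim P hp hpW
        rw [if_pos hpW, hμ]
        rcases lt_trichotomy p.ν q.ν with hlt | heq | hgt
        · have := keyW_lt_keyW_of_lt P hlt (p.src p.ν) (q.src q.ν)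
          omega
        · have hval : (q.src p.ν).val = (p.src p.ν).val + 1 := by
            rw [hs, shift_apply, if_pos rfl]
            exact val_add_one_of_ne_neg_one P hpν
          rw [← heq, hval]
          omega
        · exfalso
          have h1 : q.src q.ν = p.src q.ν := by rw [hs, shift_apply, if_neg (Fin.ne_of_lt hgt)]
          exact hqν (h1 ▸ hpW1 q.ν hgt)
      · exact absurd (hyμ ▸ hμ ▸ hqW) hpW
    · -- (c3) `⟨y, μ'⟩ = ⟨x, ν⟩`: impossible
      exfalso
      have hs : q.src = p.src := congrArg PBond.src h
      have hμ : q.μ = p.ν := congrArg PBond.dir h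
      by_cases hpW : p.src p.μ = -1
      · obtain ⟨_, hpν⟩ := memW_elim P hp hpW
        exact hpν (hs ▸ hμ ▸ hqW)
      · have h1 : q.src p.μ = -1 := hqW1 p.μ (lt_trans (hμ ▸ p.hμν) q.hμν)
        exact hpW (hs ▸ h1)
  · ---------------- `q` of F-type: pivot `⟨y, ν'⟩`, `y_{μ'} ≠ −1`
    rw [if_neg hqW] at hmem ⊢
    rcases hmem with h | h | h | h
    · -- (c1) `⟨y, ν'⟩ = ⟨x, μ⟩`: impossible
      exfalso
      have hs : q.src = p.src := congrArg PBond.src h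
      have hν : q.ν = p.μ := congrArg PBond.dir h
      have h1 : p.src q.μ = -1 := hp1 q.μ (hν ▸ q.hμν)
      exact hqW (hs ▸ h1)
    · -- (c4) `⟨y, ν'⟩ = ⟨x + e_μ, ν⟩`
      have hs : q.src = p.src.shift p.μ := congrArg PBond.src h
      have hν : q.ν = p.ν := congrArg PBond.dir h
      by_cases hpW : p.src p.μ = -1
      · -- `p` W-type: then `μ' = μ` (else `y_{μ'} = x_{μ'} = −1`), and W comes before F
        obtain ⟨hpW1, hpν⟩ := memW_elim P hp hpW
        have hμ : q.μ = p.μ := by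
          by_contra hc
          have h1 : q.src q.μ = p.src q.μ := by rw [hs, shift_apply, if_neg hc]
          exact hqW (h1.trans (hpW1 q.μ (hν ▸ q.hμν)))
        rw [if_pos hpW, hμ]
        have := keyW_lt_keyF P p.ν (p.src p.ν) (q.src p.μ)
        omega
      · rw [if_neg hpW]
        rcases lt_trichotomy p.μ q.μ with hlt | heq | hgt
        · exact rank_lt_of_stage_lt P hlt (keyF_lt P _)
        · have hval : (q.src p.μ).val = (p.src p.μ).val + 1 := by
            rw [hs, shift_apply, if_pos rfl]
            exact val_add_one_of_ne_neg_one P hpW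
          rw [← heq, hval]
          omega
        · exfalso
          have h1 : q.src q.μ = p.src q.μ := by rw [hs, shift_apply, if_neg (Fin.ne_of_lt hgt)]
          exact hqW (h1.trans (hp1 q.μ hgt))
    · -- (c2) `⟨y, ν'⟩ = ⟨x + e_ν, μ⟩`: impossible
      exfalso
      have hs : q.src = p.src.shift p.ν := congrArg PBond.src h
      have hν : q.ν = p.μ := congrArg PBond.dir h
      have hlt : q.μ < p.μ := hν ▸ q.hμν
      have h1 : p.src q.μ = -1 := hp1 q.μ hlt
      have h2 : q.src q.μ = p.src q.μ := by
        rw [hs, shift_apply, if_neg (Fin.ne_of_lt (lt_trans hlt p.hμν))]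
      exact hqW (h2.trans h1)
    · -- (c3) `⟨y, ν'⟩ = ⟨x, ν⟩`: `p = q` or impossible
      exfalso
      have hs : q.src = p.src := congrArg PBond.src h
      have hν : q.ν = p.ν := congrArg PBond.dir h
      by_cases hpW : p.src p.μ = -1
      · obtain ⟨hpW1, _⟩ := memW_elim P hp hpW
        have h1 : p.src q.μ = -1 := hpW1 q.μ (hν ▸ q.hμν)
        exact hqW (hs ▸ h1)
      · rw [hs] at hq1 hqW
        exact hne (plaq_eq P hs.symm (leastDir_unique P p.src hp1 hpW hq1 hqW) hν.symm)

end Family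

end Summit.QuantumFields.YangMills.Theorems.CoarseStiffnessTailCornerCombFamily

end
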